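import Summits.Ventures.HSemireg.CliqueUnitsClassDead
import Summits.Ventures.HSemireg.CliqueFourDigit
import Summits.Ventures.HSemireg.CliqueFiveDigit
import Summits.Ventures.HSemireg.CliqueSixDigit

/-!
# The four `q = 2` clique units are CLASS-DEAD for EVERY integral class 2-form (pub-hsemireg, S4-PUSH corner 2)

Kernel leg of seat s4-search-2 gen 17 (cell `pub-hsemireg`), ROW X2; compositions of ROW L2's `m = 1` (`q = 2`) clique units
`classDead_Km1122 ∕ Km11113 ∕ Km11112 ∕ Km111111` (types (1,1,1,1,2,2), (1,1,1,1,1,3), (1,1,1,1,1,2), (1,1,1,1,1,1); CRITERION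
L's `T_k = Σ (−2)^j σ_{k−j} D^[k−j] B^[j]`, modulus `2^{2k−1}`: `8` at `k = 2`, `32` at `k = 3`) with the clique digits of
`CliqueFourDigit ∕ CliqueFiveDigit ∕ CliqueSixDigit`.  For these types `D₂ = 4P₂ + 8E′` (L2's closed forms) and
`σ₂ = 4t − σ₀`, `σ₀ = 2s + 1`, so the registered `T₂ = σ₂D₂ − 2σ₁DB + 4σ₀B₂` is `4(B₂ − P₂) + 8W₁`; `T₂ = 8Z₂` forces
`B·B = 2P₂ + 4W₀` (cancel `4`) and the clique digit lemma gives `B = P₁ + 2Z` — ROW L2's `hB`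
(`<type>_leadingDigit_of_criterionL_two`).  Hence `classDead_<type>_of_mem_span`: ROW L2's theorem with `mZspan ∕ hB`
REPLACED by `mB : B ∈ span`, `¬(T₂ = 8·Z₂ ∧ T₃ = 32·Z')` for EVERY integral class 2-form of these types.

Scope ∕ honest framing as in ROW L2: CLASS-LEVEL, NECESSARY-condition bookkeeping (CRITERION L) at the special fibre
`E⁶`; CRITERION L as the registered necessary condition, the signature table and the census remain framework words;
theorems only (count-neutral, no `def`); no object, no `σ` computation, no Hodge statement; nothing here bears on
HC ∕ HC_CM ∕ HC_AV.
-/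

namespace Summit.Ventures.HSemireg.CliqueTwoEveryDigit

open ExteriorAlgebra DecomposableTwoForms CliqueFourDigit CliqueFiveDigit CliqueSixDigit CliqueUnitsClassDead

variable {M : Type*} [AddCommGroup M] [Module ℤ M]

/-- **The clique leading digit of type 1122 (`q = 2`), from CRITERION L at `k = 2`.**  In the setting of ROW L2's
`classDead_Km1122` the registered `T₂ = σ₂D₂ − 2σ₁DB + 4σ₀B₂` is `4(B₂ − P₂) + 8W₁`; for ANY integral class 2-form `B`
with `B·B = 2B₂`, `T₂ = 8·Z₂` forces `B = P₁ + 2Z` with `Z` in the span of the 2-vectors (ROW L2's `hB`). -/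
theorem Km1122_leadingDigit_of_criterionL_two (x : Module.Basis (Fin 12) ℤ M)
    (h₀ h₁ h₂ h₃ h₄ h₅ σ₀ σ₁ σ₂ s t P₁ P₂ D D₂ B B₂ T₂ Z₂ : ExteriorAlgebra ℤ M)
    (hh₀ : h₀ = ι ℤ (x 0) * ι ℤ (x 1)) (hh₁ : h₁ = ι ℤ (x 2) * ι ℤ (x 3)) (hh₂ : h₂ = ι ℤ (x 4) * ι ℤ (x 5)) (hh₃ : h₃ = ι ℤ (x 6) * ι ℤ (x 7))
    (hP₁ : P₁ = h₀ + h₁ + h₂ + h₃)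
    (hP₂ : P₂ = h₀ * h₁ + h₀ * h₂ + h₀ * h₃ + h₁ * h₂ + h₁ * h₃ + h₂ * h₃)
    (hD₂ : D₂ = (16) * h₄ * h₅ + (8) * P₁ * h₅ + (8) * P₁ * h₄ + (4) * P₂)
    (mB : B ∈ Submodule.span ℤ (Set.range fun p : M × M => ι ℤ p.1 * ι ℤ p.2)) (qB : B * B = 2 * B₂)
    (hσ₁ : σ₁ = 0) (hσ₂ : σ₂ = 4 * t - σ₀) (hσ₀ : σ₀ = 2 * s + 1)
    (hT₂ : T₂ = σ₂ * D₂ - 2 * σ₁ * (D * B) + 4 * σ₀ * B₂) (hcrit : T₂ = 8 * Z₂) :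
    ∃ Z ∈ Submodule.span ℤ (Set.range fun p : M × M => ι ℤ p.1 * ι ℤ p.2), B = P₁ + 2 * Z := by
  obtain ⟨W₁, hW₁⟩ : ∃ W₁ : ExteriorAlgebra ℤ M, W₁ = 2 * t * P₂ + 8 * t * (h₄ * h₅) + 4 * t * (P₁ * h₅) + 4 * t * (P₁ * h₄) - s * P₂ - 4 * s * (h₄ * h₅) - 2 * s * (P₁ * h₅) - 2 * s * (P₁ * h₄) - 2 * (h₄ * h₅) - P₁ * h₅ - P₁ * h₄ + s * B₂ := ⟨_, rfl⟩
  have e : T₂ = 8 * W₁ + 4 * (B₂ - P₂) := by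
    rw [hW₁, hT₂, hσ₁, hσ₂, hσ₀, hD₂]; noncomm_ring
  have h4 : (4 : ExteriorAlgebra ℤ M) * (B₂ - P₂) = 4 * (2 * (Z₂ - W₁)) := by
    rw [eq_sub_of_add_eq' (e.symm.trans hcrit)]; noncomm_ring
  have hB₂ : B₂ = P₂ + 2 * (Z₂ - W₁) := by
    have h := LeadingDigitRemainder.natCast_mul_cancel x 4 (by norm_num) _ _ (by exact_mod_cast h4)
    rw [← h]; abel
  have hBB : B * B = 2 * (ι ℤ (x 0) * ι ℤ (x 1) * (ι ℤ (x 2) * ι ℤ (x 3)) + ι ℤ (x 0) * ι ℤ (x 1) * (ι ℤ (x 4) * ι ℤ (x 5))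
      + ι ℤ (x 0) * ι ℤ (x 1) * (ι ℤ (x 6) * ι ℤ (x 7)) + ι ℤ (x 2) * ι ℤ (x 3) * (ι ℤ (x 4) * ι ℤ (x 5))
      + ι ℤ (x 2) * ι ℤ (x 3) * (ι ℤ (x 6) * ι ℤ (x 7)) + ι ℤ (x 4) * ι ℤ (x 5) * (ι ℤ (x 6) * ι ℤ (x 7)))
      + 4 * (Z₂ - W₁) := by
    rw [qB, hB₂, hP₂, hh₀, hh₁, hh₂, hh₃]; noncomm_ring
  obtain ⟨c, h0, hskew, hBc⟩ := exists_coeff_of_mem_span x B mB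
  obtain ⟨Z, mZ, hZ⟩ := clique4_digit x c h0 hskew B _ hBc hBB
  refine ⟨Z, mZ, ?_⟩
  rw [hP₁, hh₀, hh₁, hh₂, hh₃, hZ]

/-- **THE 1122 CLIQUE UNIT (`q = 2`) IS CLASS-DEAD FOR EVERY INTEGRAL CLASS 2-FORM.**  ROW L2's `classDead_Km1122`
with `mZspan`, `hB : B = P₁ + 2Z` REPLACED by `mB : B ∈ span` (and the registered `T₂` in the signature):
`¬(T₂ = 8·Z₂ ∧ T₃ = 32·Z')` for all `Z₂, Z'`. -/
theorem classDead_Km1122_of_mem_span (x : Module.Basis (Fin 12) ℤ M) (Λ : Subalgebra ℤ (ExteriorAlgebra ℤ M))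
    (h₀ h₁ h₂ h₃ h₄ h₅ σ₀ σ₁ σ₂ σ₃ s t u P₁ P₂ P₃ D D₂ D₃ B B₂ B₃ T₂ T₃ : ExteriorAlgebra ℤ M)
    (hΛ : Λ = Algebra.adjoin ℤ (Set.range fun p : M × M => ι ℤ p.1 * ι ℤ p.2))
    (hh₀ : h₀ = ι ℤ (x 0) * ι ℤ (x 1)) (hh₁ : h₁ = ι ℤ (x 2) * ι ℤ (x 3)) (hh₂ : h₂ = ι ℤ (x 4) * ι ℤ (x 5))
    (hh₃ : h₃ = ι ℤ (x 6) * ι ℤ (x 7)) (hh₄ : h₄ = ι ℤ (x 8) * ι ℤ (x 9)) (hh₅ : h₅ = ι ℤ (x 10) * ι ℤ (x 11))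
    (ms : s ∈ Λ) (mt : t ∈ Λ) (mu : u ∈ Λ)
    (hP₁ : P₁ = h₀ + h₁ + h₂ + h₃)
    (hP₂ : P₂ = h₀ * h₁ + h₀ * h₂ + h₀ * h₃ + h₁ * h₂ + h₁ * h₃ + h₂ * h₃)
    (hP₃ : P₃ = h₀ * h₁ * h₂ + h₀ * h₁ * h₃ + h₀ * h₂ * h₃ + h₁ * h₂ * h₃)
    (hD : D = 2 * P₁ + 4 * h₄ + 4 * h₅)
    (hD₂ : D₂ = (16) * h₄ * h₅ + (8) * P₁ * h₅ + (8) * P₁ * h₄ + (4) * P₂)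
    (hD₃ : D₃ = (32) * P₁ * h₄ * h₅ + (16) * P₂ * h₅ + (16) * P₂ * h₄ + (8) * P₃)
    (mB : B ∈ Submodule.span ℤ (Set.range fun p : M × M => ι ℤ p.1 * ι ℤ p.2))
    (qB : B * B = 2 * B₂) (cB : B * B * B = 6 * B₃)
    (hσ₁ : σ₁ = 0) (hσ₂ : σ₂ = 4 * t - σ₀) (hσ₀ : σ₀ = 2 * s + 1) (hσ₃ : σ₃ = 4 * u)
    (hT₂ : T₂ = σ₂ * D₂ - 2 * σ₁ * (D * B) + 4 * σ₀ * B₂)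
    (hT₃ : T₃ = σ₃ * D₃ - 2 * σ₂ * (D₂ * B) + 4 * σ₁ * (D * B₂) - 8 * σ₀ * B₃) :
    ∀ Z₂ Z' : ExteriorAlgebra ℤ M, ¬ (T₂ = 8 * Z₂ ∧ T₃ = 32 * Z') := by
  rintro Z₂ Z' ⟨hcrit₂, hcrit₃⟩
  obtain ⟨Z, mZ, hB⟩ := Km1122_leadingDigit_of_criterionL_two x h₀ h₁ h₂ h₃ h₄ h₅ σ₀ σ₁ σ₂ s t P₁ P₂ D D₂ B B₂
    T₂ Z₂ hh₀ hh₁ hh₂ hh₃ hP₁ hP₂ hD₂ mB qB hσ₁ hσ₂ hσ₀ hT₂ hcrit₂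
  exact classDead_Km1122 x Λ h₀ h₁ h₂ h₃ h₄ h₅ σ₀ σ₁ σ₂ σ₃ s t u P₁ P₂ P₃ D D₂ D₃ Z B B₂ B₃ T₃ hΛ hh₀ hh₁ hh₂ hh₃
    hh₄ hh₅ ms mt mu hP₁ hP₂ hP₃ hD hD₂ hD₃ mZ hB qB cB hσ₁ hσ₂ hσ₀ hσ₃ hT₃ Z' hcrit₃

/-- **The clique leading digit of type 11113 (`q = 2`), from CRITERION L at `k = 2`.**  In the setting of ROW L2's
`classDead_Km11113` the registered `T₂ = σ₂D₂ − 2σ₁DB + 4σ₀B₂` is `4(B₂ − P₂) + 8W₁`; for ANY integral class 2-form `B`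
with `B·B = 2B₂`, `T₂ = 8·Z₂` forces `B = P₁ + 2Z` with `Z` in the span of the 2-vectors (ROW L2's `hB`). -/
theorem Km11113_leadingDigit_of_criterionL_two (x : Module.Basis (Fin 12) ℤ M)
    (h₀ h₁ h₂ h₃ h₄ h₅ σ₀ σ₁ σ₂ s t P₁ P₂ D D₂ B B₂ T₂ Z₂ : ExteriorAlgebra ℤ M)
    (hh₀ : h₀ = ι ℤ (x 0) * ι ℤ (x 1)) (hh₁ : h₁ = ι ℤ (x 2) * ι ℤ (x 3)) (hh₂ : h₂ = ι ℤ (x 4) * ι ℤ (x 5)) (hh₃ : h₃ = ι ℤ (x 6) * ι ℤ (x 7)) (hh₄ : h₄ = ι ℤ (x 8) * ι ℤ (x 9))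
    (hP₁ : P₁ = h₀ + h₁ + h₂ + h₃ + h₄)
    (hP₂ : P₂ = h₀ * h₁ + h₀ * h₂ + h₀ * h₃ + h₀ * h₄ + h₁ * h₂ + h₁ * h₃ + h₁ * h₄ + h₂ * h₃ + h₂ * h₄ + h₃ * h₄)
    (hD₂ : D₂ = (16) * P₁ * h₅ + (4) * P₂)
    (mB : B ∈ Submodule.span ℤ (Set.range fun p : M × M => ι ℤ p.1 * ι ℤ p.2)) (qB : B * B = 2 * B₂)
    (hσ₁ : σ₁ = 0) (hσ₂ : σ₂ = 4 * t - σ₀) (hσ₀ : σ₀ = 2 * s + 1)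
    (hT₂ : T₂ = σ₂ * D₂ - 2 * σ₁ * (D * B) + 4 * σ₀ * B₂) (hcrit : T₂ = 8 * Z₂) :
    ∃ Z ∈ Submodule.span ℤ (Set.range fun p : M × M => ι ℤ p.1 * ι ℤ p.2), B = P₁ + 2 * Z := by
  obtain ⟨W₁, hW₁⟩ : ∃ W₁ : ExteriorAlgebra ℤ M, W₁ = 2 * t * P₂ + 8 * t * (P₁ * h₅) - s * P₂ - 4 * s * (P₁ * h₅) - 2 * (P₁ * h₅) + s * B₂ := ⟨_, rfl⟩
  have e : T₂ = 8 * W₁ + 4 * (B₂ - P₂) := by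
    rw [hW₁, hT₂, hσ₁, hσ₂, hσ₀, hD₂]; noncomm_ring
  have h4 : (4 : ExteriorAlgebra ℤ M) * (B₂ - P₂) = 4 * (2 * (Z₂ - W₁)) := by
    rw [eq_sub_of_add_eq' (e.symm.trans hcrit)]; noncomm_ring
  have hB₂ : B₂ = P₂ + 2 * (Z₂ - W₁) := by
    have h := LeadingDigitRemainder.natCast_mul_cancel x 4 (by norm_num) _ _ (by exact_mod_cast h4)
    rw [← h]; abel
  have hBB : B * B = 2 * (ι ℤ (x 0) * ι ℤ (x 1) * (ι ℤ (x 2) * ι ℤ (x 3)) + ι ℤ (x 0) * ι ℤ (x 1) * (ι ℤ (x 4) * ι ℤ (x 5))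
      + ι ℤ (x 0) * ι ℤ (x 1) * (ι ℤ (x 6) * ι ℤ (x 7)) + ι ℤ (x 0) * ι ℤ (x 1) * (ι ℤ (x 8) * ι ℤ (x 9))
      + ι ℤ (x 2) * ι ℤ (x 3) * (ι ℤ (x 4) * ι ℤ (x 5)) + ι ℤ (x 2) * ι ℤ (x 3) * (ι ℤ (x 6) * ι ℤ (x 7))
      + ι ℤ (x 2) * ι ℤ (x 3) * (ι ℤ (x 8) * ι ℤ (x 9)) + ι ℤ (x 4) * ι ℤ (x 5) * (ι ℤ (x 6) * ι ℤ (x 7))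
      + ι ℤ (x 4) * ι ℤ (x 5) * (ι ℤ (x 8) * ι ℤ (x 9)) + ι ℤ (x 6) * ι ℤ (x 7) * (ι ℤ (x 8) * ι ℤ (x 9)))
      + 4 * (Z₂ - W₁) := by
    rw [qB, hB₂, hP₂, hh₀, hh₁, hh₂, hh₃, hh₄]; noncomm_ring
  obtain ⟨c, h0, hskew, hBc⟩ := exists_coeff_of_mem_span x B mB
  obtain ⟨Z, mZ, hZ⟩ := clique5_digit x c h0 hskew B _ hBc hBB
  refine ⟨Z, mZ, ?_⟩
  rw [hP₁, hh₀, hh₁, hh₂, hh₃, hh₄, hZ]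

/-- **THE 11113 CLIQUE UNIT (`q = 2`) IS CLASS-DEAD FOR EVERY INTEGRAL CLASS 2-FORM.**  ROW L2's `classDead_Km11113`
with `mZspan`, `hB : B = P₁ + 2Z` REPLACED by `mB : B ∈ span` (and the registered `T₂` in the signature):
`¬(T₂ = 8·Z₂ ∧ T₃ = 32·Z')` for all `Z₂, Z'`. -/
theorem classDead_Km11113_of_mem_span (x : Module.Basis (Fin 12) ℤ M) (Λ : Subalgebra ℤ (ExteriorAlgebra ℤ M))
    (h₀ h₁ h₂ h₃ h₄ h₅ σ₀ σ₁ σ₂ σ₃ s t u P₁ P₂ P₃ D D₂ D₃ B B₂ B₃ T₂ T₃ : ExteriorAlgebra ℤ M)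
    (hΛ : Λ = Algebra.adjoin ℤ (Set.range fun p : M × M => ι ℤ p.1 * ι ℤ p.2))
    (hh₀ : h₀ = ι ℤ (x 0) * ι ℤ (x 1)) (hh₁ : h₁ = ι ℤ (x 2) * ι ℤ (x 3)) (hh₂ : h₂ = ι ℤ (x 4) * ι ℤ (x 5))
    (hh₃ : h₃ = ι ℤ (x 6) * ι ℤ (x 7)) (hh₄ : h₄ = ι ℤ (x 8) * ι ℤ (x 9)) (hh₅ : h₅ = ι ℤ (x 10) * ι ℤ (x 11))
    (ms : s ∈ Λ) (mt : t ∈ Λ) (mu : u ∈ Λ)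
    (hP₁ : P₁ = h₀ + h₁ + h₂ + h₃ + h₄)
    (hP₂ : P₂ = h₀ * h₁ + h₀ * h₂ + h₀ * h₃ + h₀ * h₄ + h₁ * h₂ + h₁ * h₃ + h₁ * h₄ + h₂ * h₃ + h₂ * h₄ + h₃ * h₄)
    (hP₃ : P₃ = h₀ * h₁ * h₂ + h₀ * h₁ * h₃ + h₀ * h₁ * h₄ + h₀ * h₂ * h₃ + h₀ * h₂ * h₄ + h₀ * h₃ * h₄ + h₁ * h₂ * h₃ +
      h₁ * h₂ * h₄ + h₁ * h₃ * h₄ + h₂ * h₃ * h₄)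
    (hD : D = 2 * P₁ + 8 * h₅)
    (hD₂ : D₂ = (16) * P₁ * h₅ + (4) * P₂)
    (hD₃ : D₃ = (32) * P₂ * h₅ + (8) * P₃)
    (mB : B ∈ Submodule.span ℤ (Set.range fun p : M × M => ι ℤ p.1 * ι ℤ p.2))
    (qB : B * B = 2 * B₂) (cB : B * B * B = 6 * B₃)
    (hσ₁ : σ₁ = 0) (hσ₂ : σ₂ = 4 * t - σ₀) (hσ₀ : σ₀ = 2 * s + 1) (hσ₃ : σ₃ = 4 * u)
    (hT₂ : T₂ = σ₂ * D₂ - 2 * σ₁ * (D * B) + 4 * σ₀ * B₂)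
    (hT₃ : T₃ = σ₃ * D₃ - 2 * σ₂ * (D₂ * B) + 4 * σ₁ * (D * B₂) - 8 * σ₀ * B₃) :
    ∀ Z₂ Z' : ExteriorAlgebra ℤ M, ¬ (T₂ = 8 * Z₂ ∧ T₃ = 32 * Z') := by
  rintro Z₂ Z' ⟨hcrit₂, hcrit₃⟩
  obtain ⟨Z, mZ, hB⟩ := Km11113_leadingDigit_of_criterionL_two x h₀ h₁ h₂ h₃ h₄ h₅ σ₀ σ₁ σ₂ s t P₁ P₂ D D₂ B B₂
    T₂ Z₂ hh₀ hh₁ hh₂ hh₃ hh₄ hP₁ hP₂ hD₂ mB qB hσ₁ hσ₂ hσ₀ hT₂ hcrit₂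
  exact classDead_Km11113 x Λ h₀ h₁ h₂ h₃ h₄ h₅ σ₀ σ₁ σ₂ σ₃ s t u P₁ P₂ P₃ D D₂ D₃ Z B B₂ B₃ T₃ hΛ hh₀ hh₁ hh₂ hh₃
    hh₄ hh₅ ms mt mu hP₁ hP₂ hP₃ hD hD₂ hD₃ mZ hB qB cB hσ₁ hσ₂ hσ₀ hσ₃ hT₃ Z' hcrit₃

/-- **The clique leading digit of type 11112 (`q = 2`), from CRITERION L at `k = 2`.**  In the setting of ROW L2's
`classDead_Km11112` the registered `T₂ = σ₂D₂ − 2σ₁DB + 4σ₀B₂` is `4(B₂ − P₂) + 8W₁`; for ANY integral class 2-form `B`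
with `B·B = 2B₂`, `T₂ = 8·Z₂` forces `B = P₁ + 2Z` with `Z` in the span of the 2-vectors (ROW L2's `hB`). -/
theorem Km11112_leadingDigit_of_criterionL_two (x : Module.Basis (Fin 12) ℤ M)
    (h₀ h₁ h₂ h₃ h₄ h₅ σ₀ σ₁ σ₂ s t P₁ P₂ D D₂ B B₂ T₂ Z₂ : ExteriorAlgebra ℤ M)
    (hh₀ : h₀ = ι ℤ (x 0) * ι ℤ (x 1)) (hh₁ : h₁ = ι ℤ (x 2) * ι ℤ (x 3)) (hh₂ : h₂ = ι ℤ (x 4) * ι ℤ (x 5)) (hh₃ : h₃ = ι ℤ (x 6) * ι ℤ (x 7)) (hh₄ : h₄ = ι ℤ (x 8) * ι ℤ (x 9))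
    (hP₁ : P₁ = h₀ + h₁ + h₂ + h₃ + h₄)
    (hP₂ : P₂ = h₀ * h₁ + h₀ * h₂ + h₀ * h₃ + h₀ * h₄ + h₁ * h₂ + h₁ * h₃ + h₁ * h₄ + h₂ * h₃ + h₂ * h₄ + h₃ * h₄)
    (hD₂ : D₂ = (8) * P₁ * h₅ + (4) * P₂)
    (mB : B ∈ Submodule.span ℤ (Set.range fun p : M × M => ι ℤ p.1 * ι ℤ p.2)) (qB : B * B = 2 * B₂)
    (hσ₁ : σ₁ = 0) (hσ₂ : σ₂ = 4 * t - σ₀) (hσ₀ : σ₀ = 2 * s + 1)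
    (hT₂ : T₂ = σ₂ * D₂ - 2 * σ₁ * (D * B) + 4 * σ₀ * B₂) (hcrit : T₂ = 8 * Z₂) :
    ∃ Z ∈ Submodule.span ℤ (Set.range fun p : M × M => ι ℤ p.1 * ι ℤ p.2), B = P₁ + 2 * Z := by
  obtain ⟨W₁, hW₁⟩ : ∃ W₁ : ExteriorAlgebra ℤ M, W₁ = 2 * t * P₂ + 4 * t * (P₁ * h₅) - s * P₂ - 2 * s * (P₁ * h₅) - P₁ * h₅ + s * B₂ := ⟨_, rfl⟩
  have e : T₂ = 8 * W₁ + 4 * (B₂ - P₂) := by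
    rw [hW₁, hT₂, hσ₁, hσ₂, hσ₀, hD₂]; noncomm_ring
  have h4 : (4 : ExteriorAlgebra ℤ M) * (B₂ - P₂) = 4 * (2 * (Z₂ - W₁)) := by
    rw [eq_sub_of_add_eq' (e.symm.trans hcrit)]; noncomm_ring
  have hB₂ : B₂ = P₂ + 2 * (Z₂ - W₁) := by
    have h := LeadingDigitRemainder.natCast_mul_cancel x 4 (by norm_num) _ _ (by exact_mod_cast h4)
    rw [← h]; abel
  have hBB : B * B = 2 * (ι ℤ (x 0) * ι ℤ (x 1) * (ι ℤ (x 2) * ι ℤ (x 3)) + ι ℤ (x 0) * ι ℤ (x 1) * (ι ℤ (x 4) * ι ℤ (x 5))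
      + ι ℤ (x 0) * ι ℤ (x 1) * (ι ℤ (x 6) * ι ℤ (x 7)) + ι ℤ (x 0) * ι ℤ (x 1) * (ι ℤ (x 8) * ι ℤ (x 9))
      + ι ℤ (x 2) * ι ℤ (x 3) * (ι ℤ (x 4) * ι ℤ (x 5)) + ι ℤ (x 2) * ι ℤ (x 3) * (ι ℤ (x 6) * ι ℤ (x 7))
      + ι ℤ (x 2) * ι ℤ (x 3) * (ι ℤ (x 8) * ι ℤ (x 9)) + ι ℤ (x 4) * ι ℤ (x 5) * (ι ℤ (x 6) * ι ℤ (x 7))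
      + ι ℤ (x 4) * ι ℤ (x 5) * (ι ℤ (x 8) * ι ℤ (x 9)) + ι ℤ (x 6) * ι ℤ (x 7) * (ι ℤ (x 8) * ι ℤ (x 9)))
      + 4 * (Z₂ - W₁) := by
    rw [qB, hB₂, hP₂, hh₀, hh₁, hh₂, hh₃, hh₄]; noncomm_ring
  obtain ⟨c, h0, hskew, hBc⟩ := exists_coeff_of_mem_span x B mB
  obtain ⟨Z, mZ, hZ⟩ := clique5_digit x c h0 hskew B _ hBc hBB
  refine ⟨Z, mZ, ?_⟩
  rw [hP₁, hh₀, hh₁, hh₂, hh₃, hh₄, hZ]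

/-- **THE 11112 CLIQUE UNIT (`q = 2`) IS CLASS-DEAD FOR EVERY INTEGRAL CLASS 2-FORM.**  ROW L2's `classDead_Km11112`
with `mZspan`, `hB : B = P₁ + 2Z` REPLACED by `mB : B ∈ span` (and the registered `T₂` in the signature):
`¬(T₂ = 8·Z₂ ∧ T₃ = 32·Z')` for all `Z₂, Z'`. -/
theorem classDead_Km11112_of_mem_span (x : Module.Basis (Fin 12) ℤ M) (Λ : Subalgebra ℤ (ExteriorAlgebra ℤ M))
    (h₀ h₁ h₂ h₃ h₄ h₅ σ₀ σ₁ σ₂ σ₃ s t u P₁ P₂ P₃ D D₂ D₃ B B₂ B₃ T₂ T₃ : ExteriorAlgebra ℤ M)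
    (hΛ : Λ = Algebra.adjoin ℤ (Set.range fun p : M × M => ι ℤ p.1 * ι ℤ p.2))
    (hh₀ : h₀ = ι ℤ (x 0) * ι ℤ (x 1)) (hh₁ : h₁ = ι ℤ (x 2) * ι ℤ (x 3)) (hh₂ : h₂ = ι ℤ (x 4) * ι ℤ (x 5))
    (hh₃ : h₃ = ι ℤ (x 6) * ι ℤ (x 7)) (hh₄ : h₄ = ι ℤ (x 8) * ι ℤ (x 9)) (hh₅ : h₅ = ι ℤ (x 10) * ι ℤ (x 11))
    (ms : s ∈ Λ) (mt : t ∈ Λ) (mu : u ∈ Λ)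
    (hP₁ : P₁ = h₀ + h₁ + h₂ + h₃ + h₄)
    (hP₂ : P₂ = h₀ * h₁ + h₀ * h₂ + h₀ * h₃ + h₀ * h₄ + h₁ * h₂ + h₁ * h₃ + h₁ * h₄ + h₂ * h₃ + h₂ * h₄ + h₃ * h₄)
    (hP₃ : P₃ = h₀ * h₁ * h₂ + h₀ * h₁ * h₃ + h₀ * h₁ * h₄ + h₀ * h₂ * h₃ + h₀ * h₂ * h₄ + h₀ * h₃ * h₄ + h₁ * h₂ * h₃ +
      h₁ * h₂ * h₄ + h₁ * h₃ * h₄ + h₂ * h₃ * h₄)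
    (hD : D = 2 * P₁ + 4 * h₅)
    (hD₂ : D₂ = (8) * P₁ * h₅ + (4) * P₂)
    (hD₃ : D₃ = (16) * P₂ * h₅ + (8) * P₃)
    (mB : B ∈ Submodule.span ℤ (Set.range fun p : M × M => ι ℤ p.1 * ι ℤ p.2))
    (qB : B * B = 2 * B₂) (cB : B * B * B = 6 * B₃)
    (hσ₁ : σ₁ = 0) (hσ₂ : σ₂ = 4 * t - σ₀) (hσ₀ : σ₀ = 2 * s + 1) (hσ₃ : σ₃ = 4 * u)
    (hT₂ : T₂ = σ₂ * D₂ - 2 * σ₁ * (D * B) + 4 * σ₀ * B₂)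
    (hT₃ : T₃ = σ₃ * D₃ - 2 * σ₂ * (D₂ * B) + 4 * σ₁ * (D * B₂) - 8 * σ₀ * B₃) :
    ∀ Z₂ Z' : ExteriorAlgebra ℤ M, ¬ (T₂ = 8 * Z₂ ∧ T₃ = 32 * Z') := by
  rintro Z₂ Z' ⟨hcrit₂, hcrit₃⟩
  obtain ⟨Z, mZ, hB⟩ := Km11112_leadingDigit_of_criterionL_two x h₀ h₁ h₂ h₃ h₄ h₅ σ₀ σ₁ σ₂ s t P₁ P₂ D D₂ B B₂
    T₂ Z₂ hh₀ hh₁ hh₂ hh₃ hh₄ hP₁ hP₂ hD₂ mB qB hσ₁ hσ₂ hσ₀ hT₂ hcrit₂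
  exact classDead_Km11112 x Λ h₀ h₁ h₂ h₃ h₄ h₅ σ₀ σ₁ σ₂ σ₃ s t u P₁ P₂ P₃ D D₂ D₃ Z B B₂ B₃ T₃ hΛ hh₀ hh₁ hh₂ hh₃
    hh₄ hh₅ ms mt mu hP₁ hP₂ hP₃ hD hD₂ hD₃ mZ hB qB cB hσ₁ hσ₂ hσ₀ hσ₃ hT₃ Z' hcrit₃

/-- **The clique leading digit of type 111111 (`q = 2`), from CRITERION L at `k = 2`.**  In the setting of ROW L2's
`classDead_Km111111` the registered `T₂ = σ₂D₂ − 2σ₁DB + 4σ₀B₂` is `4(B₂ − P₂) + 8W₁`; for ANY integral class 2-form `B`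
with `B·B = 2B₂`, `T₂ = 8·Z₂` forces `B = P₁ + 2Z` with `Z` in the span of the 2-vectors (ROW L2's `hB`). -/
theorem Km111111_leadingDigit_of_criterionL_two (x : Module.Basis (Fin 12) ℤ M)
    (h₀ h₁ h₂ h₃ h₄ h₅ σ₀ σ₁ σ₂ s t P₁ P₂ D D₂ B B₂ T₂ Z₂ : ExteriorAlgebra ℤ M)
    (hh₀ : h₀ = ι ℤ (x 0) * ι ℤ (x 1)) (hh₁ : h₁ = ι ℤ (x 2) * ι ℤ (x 3)) (hh₂ : h₂ = ι ℤ (x 4) * ι ℤ (x 5)) (hh₃ : h₃ = ι ℤ (x 6) * ι ℤ (x 7)) (hh₄ : h₄ = ι ℤ (x 8) * ι ℤ (x 9)) (hh₅ : h₅ = ι ℤ (x 10) * ι ℤ (x 11))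
    (hP₁ : P₁ = h₀ + h₁ + h₂ + h₃ + h₄ + h₅)
    (hP₂ : P₂ = h₀ * h₁ + h₀ * h₂ + h₀ * h₃ + h₀ * h₄ + h₀ * h₅ + h₁ * h₂ + h₁ * h₃ + h₁ * h₄ + h₁ * h₅ + h₂ * h₃ + h₂ *
      h₄ + h₂ * h₅ + h₃ * h₄ + h₃ * h₅ + h₄ * h₅)
    (hD₂ : D₂ = (4) * P₂)
    (mB : B ∈ Submodule.span ℤ (Set.range fun p : M × M => ι ℤ p.1 * ι ℤ p.2)) (qB : B * B = 2 * B₂)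
    (hσ₁ : σ₁ = 0) (hσ₂ : σ₂ = 4 * t - σ₀) (hσ₀ : σ₀ = 2 * s + 1)
    (hT₂ : T₂ = σ₂ * D₂ - 2 * σ₁ * (D * B) + 4 * σ₀ * B₂) (hcrit : T₂ = 8 * Z₂) :
    ∃ Z ∈ Submodule.span ℤ (Set.range fun p : M × M => ι ℤ p.1 * ι ℤ p.2), B = P₁ + 2 * Z := by
  obtain ⟨W₁, hW₁⟩ : ∃ W₁ : ExteriorAlgebra ℤ M, W₁ = 2 * t * P₂ - s * P₂ + s * B₂ := ⟨_, rfl⟩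
  have e : T₂ = 8 * W₁ + 4 * (B₂ - P₂) := by
    rw [hW₁, hT₂, hσ₁, hσ₂, hσ₀, hD₂]; noncomm_ring
  have h4 : (4 : ExteriorAlgebra ℤ M) * (B₂ - P₂) = 4 * (2 * (Z₂ - W₁)) := by
    rw [eq_sub_of_add_eq' (e.symm.trans hcrit)]; noncomm_ring
  have hB₂ : B₂ = P₂ + 2 * (Z₂ - W₁) := by
    have h := LeadingDigitRemainder.natCast_mul_cancel x 4 (by norm_num) _ _ (by exact_mod_cast h4)
    rw [← h]; abel
  have hBB : B * B = 2 * (ι ℤ (x 0) * ι ℤ (x 1) * (ι ℤ (x 2) * ι ℤ (x 3)) + ι ℤ (x 0) * ι ℤ (x 1) * (ι ℤ (x 4) * ι ℤ (x 5))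
      + ι ℤ (x 0) * ι ℤ (x 1) * (ι ℤ (x 6) * ι ℤ (x 7)) + ι ℤ (x 0) * ι ℤ (x 1) * (ι ℤ (x 8) * ι ℤ (x 9))
      + ι ℤ (x 0) * ι ℤ (x 1) * (ι ℤ (x 10) * ι ℤ (x 11)) + ι ℤ (x 2) * ι ℤ (x 3) * (ι ℤ (x 4) * ι ℤ (x 5))
      + ι ℤ (x 2) * ι ℤ (x 3) * (ι ℤ (x 6) * ι ℤ (x 7)) + ι ℤ (x 2) * ι ℤ (x 3) * (ι ℤ (x 8) * ι ℤ (x 9))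
      + ι ℤ (x 2) * ι ℤ (x 3) * (ι ℤ (x 10) * ι ℤ (x 11)) + ι ℤ (x 4) * ι ℤ (x 5) * (ι ℤ (x 6) * ι ℤ (x 7))
      + ι ℤ (x 4) * ι ℤ (x 5) * (ι ℤ (x 8) * ι ℤ (x 9)) + ι ℤ (x 4) * ι ℤ (x 5) * (ι ℤ (x 10) * ι ℤ (x 11))
      + ι ℤ (x 6) * ι ℤ (x 7) * (ι ℤ (x 8) * ι ℤ (x 9)) + ι ℤ (x 6) * ι ℤ (x 7) * (ι ℤ (x 10) * ι ℤ (x 11))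
      + ι ℤ (x 8) * ι ℤ (x 9) * (ι ℤ (x 10) * ι ℤ (x 11)))
      + 4 * (Z₂ - W₁) := by
    rw [qB, hB₂, hP₂, hh₀, hh₁, hh₂, hh₃, hh₄, hh₅]; noncomm_ring
  obtain ⟨c, h0, hskew, hBc⟩ := exists_coeff_of_mem_span x B mB
  obtain ⟨Z, mZ, hZ⟩ := clique6_digit x c h0 hskew B _ hBc hBB
  refine ⟨Z, mZ, ?_⟩
  rw [hP₁, hh₀, hh₁, hh₂, hh₃, hh₄, hh₅, hZ]

/-- **THE 111111 CLIQUE UNIT (`q = 2`) IS CLASS-DEAD FOR EVERY INTEGRAL CLASS 2-FORM.**  ROW L2's `classDead_Km111111`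
with `mZspan`, `hB : B = P₁ + 2Z` REPLACED by `mB : B ∈ span` (and the registered `T₂` in the signature):
`¬(T₂ = 8·Z₂ ∧ T₃ = 32·Z')` for all `Z₂, Z'`. -/
theorem classDead_Km111111_of_mem_span (x : Module.Basis (Fin 12) ℤ M) (Λ : Subalgebra ℤ (ExteriorAlgebra ℤ M))
    (h₀ h₁ h₂ h₃ h₄ h₅ σ₀ σ₁ σ₂ σ₃ s t u P₁ P₂ P₃ D D₂ D₃ B B₂ B₃ T₂ T₃ : ExteriorAlgebra ℤ M)
    (hΛ : Λ = Algebra.adjoin ℤ (Set.range fun p : M × M => ι ℤ p.1 * ι ℤ p.2))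
    (hh₀ : h₀ = ι ℤ (x 0) * ι ℤ (x 1)) (hh₁ : h₁ = ι ℤ (x 2) * ι ℤ (x 3)) (hh₂ : h₂ = ι ℤ (x 4) * ι ℤ (x 5))
    (hh₃ : h₃ = ι ℤ (x 6) * ι ℤ (x 7)) (hh₄ : h₄ = ι ℤ (x 8) * ι ℤ (x 9)) (hh₅ : h₅ = ι ℤ (x 10) * ι ℤ (x 11))
    (ms : s ∈ Λ) (mt : t ∈ Λ) (mu : u ∈ Λ)
    (hP₁ : P₁ = h₀ + h₁ + h₂ + h₃ + h₄ + h₅)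
    (hP₂ : P₂ = h₀ * h₁ + h₀ * h₂ + h₀ * h₃ + h₀ * h₄ + h₀ * h₅ + h₁ * h₂ + h₁ * h₃ + h₁ * h₄ + h₁ * h₅ + h₂ * h₃ + h₂ *
      h₄ + h₂ * h₅ + h₃ * h₄ + h₃ * h₅ + h₄ * h₅)
    (hP₃ : P₃ = h₀ * h₁ * h₂ + h₀ * h₁ * h₃ + h₀ * h₁ * h₄ + h₀ * h₁ * h₅ + h₀ * h₂ * h₃ + h₀ * h₂ * h₄ + h₀ * h₂ * h₅ +
      h₀ * h₃ * h₄ + h₀ * h₃ * h₅ + h₀ * h₄ * h₅ + h₁ * h₂ * h₃ + h₁ * h₂ * h₄ + h₁ * h₂ * h₅ + h₁ * h₃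
      * h₄ + h₁ * h₃ * h₅ + h₁ * h₄ * h₅ + h₂ * h₃ * h₄ + h₂ * h₃ * h₅ + h₂ * h₄ * h₅ + h₃ * h₄ * h₅)
    (hD : D = 2 * P₁)
    (hD₂ : D₂ = (4) * P₂)
    (hD₃ : D₃ = (8) * P₃)
    (mB : B ∈ Submodule.span ℤ (Set.range fun p : M × M => ι ℤ p.1 * ι ℤ p.2))
    (qB : B * B = 2 * B₂) (cB : B * B * B = 6 * B₃)
    (hσ₁ : σ₁ = 0) (hσ₂ : σ₂ = 4 * t - σ₀) (hσ₀ : σ₀ = 2 * s + 1) (hσ₃ : σ₃ = 4 * u)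
    (hT₂ : T₂ = σ₂ * D₂ - 2 * σ₁ * (D * B) + 4 * σ₀ * B₂)
    (hT₃ : T₃ = σ₃ * D₃ - 2 * σ₂ * (D₂ * B) + 4 * σ₁ * (D * B₂) - 8 * σ₀ * B₃) :
    ∀ Z₂ Z' : ExteriorAlgebra ℤ M, ¬ (T₂ = 8 * Z₂ ∧ T₃ = 32 * Z') := by
  rintro Z₂ Z' ⟨hcrit₂, hcrit₃⟩
  obtain ⟨Z, mZ, hB⟩ := Km111111_leadingDigit_of_criterionL_two x h₀ h₁ h₂ h₃ h₄ h₅ σ₀ σ₁ σ₂ s t P₁ P₂ D D₂ B B₂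
    T₂ Z₂ hh₀ hh₁ hh₂ hh₃ hh₄ hh₅ hP₁ hP₂ hD₂ mB qB hσ₁ hσ₂ hσ₀ hT₂ hcrit₂
  exact classDead_Km111111 x Λ h₀ h₁ h₂ h₃ h₄ h₅ σ₀ σ₁ σ₂ σ₃ s t u P₁ P₂ P₃ D D₂ D₃ Z B B₂ B₃ T₃ hΛ hh₀ hh₁ hh₂ hh₃
    hh₄ hh₅ ms mt mu hP₁ hP₂ hP₃ hD hD₂ hD₃ mZ hB qB cB hσ₁ hσ₂ hσ₀ hσ₃ hT₃ Z' hcrit₃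

end Summit.Ventures.HSemireg.CliqueTwoEveryDigit
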